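import Literature.MathematicalPhysics.QuantumManyBody.PeriodicWeightedFormCompact
import Literature.MathematicalPhysics.QuantumManyBody.PeriodicFormSpectrum
import HarnessLib

/-!
# The lowest form eigenvalues of `-∑ⱼΔⱼ + W` on the torus (abstract weight): `periodicGroundStateEnergyW`
# is the lowest eigenvalue, Ky Fan lower bound for orthogonal pairs

Topic `Literature/MathematicalPhysics/QuantumManyBody`, sequel of `PeriodicWeightedFormCompact.lean`;
abstract-weight twin of `PeriodicFormSpectrum.lean` (same statements and proofs with `periodicInteraction v L ↦ W`,
`periodicEnergy v ↦ periodicEnergyW W`, `periodicGroundStateEnergy v N L ↦ periodicGroundStateEnergyW W L`, under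
`hWm : Measurable W`, `hW : ∫⁻ X in cellN N L, W X ≠ ⊤`).

For `0 < L`, `1 ≤ N`: the spectral data `d : TwoModeData (formEmbedW …)` of the two top eigenpairs
`(κ₁, e₁), (κ₂, e₂)` of the Gram operator of the compact form embedding exist (`nonempty_twoModeDataW`: the
constant and a symmetrised plane wave are orthogonal core functions; Rellich); every trial state has energy
`≥ κ₁⁻¹ - 1` and every `L²`-orthogonal pair total energy `≥ κ₁⁻¹ + κ₂⁻¹ - 2` (Ky Fan,
`le_add_periodicEnergyW_of_twoModeData`); and **the variational ground-state energy is the lowest form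
eigenvalue**, `periodicGroundStateEnergyW W L = κ₁⁻¹ - 1` (`periodicGroundStateEnergyW_eq_ofReal`, density of the
core in `Q`) [ReedSimonIV1978, Thm. XIII.1–2 and XIII.64]. (The identification of the Ky Fan two-sum with
`κ₁⁻¹ + κ₂⁻¹ - 2` of the pair file is not repeated: the sequel files only use the lower bound.)

## References
* [ReedSimonIV1978] Reed–Simon IV, Thm. XIII.1–XIII.2 (min–max), XIII.64 (compact resolvent).
* [BoccatoEtAl2019Acta] Boccato–Brennecke–Cenatiempo–Schlein, Acta Math. 222 (2019), §6 (min–max, `m ≤ 2`).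
-/

noncomputable section

open MeasureTheory Filter Set WithLp Complex UnitAddTorus
open scoped ENNReal NNReal Topology ComplexConjugate InnerProductSpace
open Literature.Analysis.InnerProduct

namespace Literature.MathematicalPhysics.QuantumManyBody.BoseGas

-- The measure on `ℝ/ℤ` is the Haar PROBABILITY measure, as in `PeriodicFormDomain.lean`.
attribute [local instance] formDomain_measureSpace formDomain_isProbabilityMeasure formDomain_isProbabilityMeasure_pi

variable {N : ℕ} {L : ℝ} {W : Config N → ℝ≥0∞}

/-- Local notation for the Hilbert space `H = L²((ℝ/ℤ)^{3N})`. -/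
local notation "L2T " N':max => Lp ℂ 2 (volume : Measure (UnitAddTorus (Fin N' × Fin 3)))


/-- The form domain is complete: a closed subspace of the Hilbert space `⨁_c L²((ℝ/ℤ)^{3N})`
(instance for the `def` `formDomainW`, which typeclass search does not unfold). [folklore] -/
instance formDomainW.instCompleteSpace (hL : 0 < L) (hWm : Measurable W)
    (hW : ∫⁻ X in cellN N L, W X ≠ ⊤) : CompleteSpace (formDomainW hL hWm hW) :=
  inferInstanceAs (CompleteSpace (LinearMap.range (graphEmbedW hL hWm hW)).topologicalClosure)


/-- `‖ι(graphEmbedW 1)‖² = L^{3N}`: the constant function has non-zero image. [folklore] -/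
theorem norm_formEmbedW_graphEmbedW_const_sq (hL : 0 < L) (hWm : Measurable W)
    (hW : ∫⁻ X in cellN N L, W X ≠ ⊤) :
    ‖formEmbedW hL hWm hW ⟨graphEmbedW hL hWm hW ⟨fun _ => (1 : ℂ), const_mem_periodicCore N L 1⟩,
      graphEmbedW_mem_formDomainW hL hWm hW _⟩‖ ^ 2 = (L ^ 3) ^ N := by
  rw [norm_formEmbedW_graphEmbedW_sq]
  show (∫⁻ X in cellN N L, ((‖(1 : ℂ)‖₊ : ℝ≥0∞)) ^ 2).toReal = (L ^ 3) ^ N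
  rw [nnnorm_one, ENNReal.coe_one, one_pow, setLIntegral_const, one_mul, volume_cellN,
    ENNReal.toReal_pow, ENNReal.toReal_pow, ENNReal.toReal_ofReal hL.le]

/-- **Two `L²`-orthogonal core functions with non-zero images** (`N ≥ 1`): the constant `1` and the
symmetrised plane wave `∑ⱼ e_n(xⱼ)`, `n ≠ 0`. [folklore] -/
theorem exists_orthogonal_formEmbedW (hL : 0 < L) (hWm : Measurable W)
    (hW : ∫⁻ X in cellN N L, W X ≠ ⊤) (hN : 0 < N) :
    ∃ x y : formDomainW hL hWm hW, ⟪formEmbedW hL hWm hW x, formEmbedW hL hWm hW y⟫_ℂ = 0 ∧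
      formEmbedW hL hWm hW x ≠ 0 ∧ formEmbedW hL hWm hW y ≠ 0 := by
  set n₀ : Fin 3 → ℤ := fun _ => 1 with hn₀
  have hn₀' : n₀ ≠ 0 := fun h => by simpa [hn₀] using congrFun h 0
  set Ψ : periodicCore N L := ⟨fun _ => (1 : ℂ), const_mem_periodicCore N L 1⟩ with hΨ
  set Φ : periodicCore N L := ⟨planeWaveSum L n₀, planeWaveSum_mem_periodicCore hL.ne' n₀⟩ with hΦ
  refine ⟨⟨graphEmbedW hL hWm hW Ψ, graphEmbedW_mem_formDomainW hL hWm hW Ψ⟩,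
    ⟨graphEmbedW hL hWm hW Φ, graphEmbedW_mem_formDomainW hL hWm hW Φ⟩, ?_, ?_, ?_⟩
  · rw [inner_formEmbedW_graphEmbedW]
    show ∫ X in cellN N L, conj (1 : ℂ) * planeWaveSum L n₀ X = 0
    simp only [map_one, one_mul]
    exact integral_cellN_planeWaveSum hL hn₀'
  · intro h0
    have h := norm_formEmbedW_graphEmbedW_const_sq hL hWm hW (N := N)
    rw [h0, norm_zero, zero_pow two_ne_zero] at h
    exact absurd h.symm (by positivity)
  · intro h0
    have h := norm_formEmbedW_graphEmbedW_sq hL hWm hW Φ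
    rw [h0, norm_zero, zero_pow two_ne_zero] at h
    rcases (ENNReal.toReal_eq_zero_iff _).1 h.symm with h1 | h1
    · exact lintegral_planeWaveSum_ne_zero hL hN n₀ h1
    · exact lintegral_planeWaveSum_ne_top (M := N) L n₀ h1

/-- **The spectral data of the two lowest eigenvalues exist** for the periodic `N`-body form
(`N ≥ 1`, `L > 0`, `W ∈ L¹` of the cell): `Literature.Analysis.InnerProduct.exists_twoModeData`
applied to the compact embedding `formEmbedW`. [cite: ReedSimonIV1978, Thm. XIII.64] -/
theorem nonempty_twoModeDataW (hL : 0 < L) (hWm : Measurable W)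
    (hW : ∫⁻ X in cellN N L, W X ≠ ⊤) (hN : 0 < N) :
    Nonempty (TwoModeData (formEmbedW hL hWm hW)) :=
  exists_twoModeData _ (isCompactOperator_formEmbedW hL hWm hW) (exists_orthogonal_formEmbedW hL hWm hW hN)

/-! ### The dictionary between `TwoModeData` and the variational energies -/

/-- `‖ι ξ‖ ≤ ‖ξ‖_Q` (the value component of the graph norm). [folklore] -/
theorem norm_formEmbedW_le (hL : 0 < L) (hWm : Measurable W)
    (hW : ∫⁻ X in cellN N L, W X ≠ ⊤) (ξ : formDomainW hL hWm hW) :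
    ‖formEmbedW hL hWm hW ξ‖ ≤ ‖ξ‖ := by
  rw [formEmbedW_apply]
  exact PiLp.norm_apply_le _ _

/-- `κ₁ ≤ 1`, i.e. the lowest form eigenvalue `E₁ = κ₁⁻¹ - 1` is non-negative. [folklore] -/
theorem twoModeDataW_κ₁_le_one {hL : 0 < L} {hWm : Measurable W}
    {hW : ∫⁻ X in cellN N L, W X ≠ ⊤} (d : TwoModeData (formEmbedW hL hWm hW)) :
    d.κ₁ ≤ 1 := by
  have h1 := d.norm_map_e₁_sq
  have h2 := norm_formEmbedW_le hL hWm hW d.e₁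
  rw [d.norm_e₁] at h2
  calc d.κ₁ = ‖formEmbedW hL hWm hW d.e₁‖ ^ 2 := h1.symm
    _ ≤ 1 ^ 2 := by gcongr
    _ = 1 := one_pow 2

/-- `1 ≤ κ₁⁻¹` (`E₁ = κ₁⁻¹ - 1 ≥ 0`). [folklore] -/
theorem twoModeDataW_one_le_inv_κ₁ {hL : 0 < L} {hWm : Measurable W}
    {hW : ∫⁻ X in cellN N L, W X ≠ ⊤} (d : TwoModeData (formEmbedW hL hWm hW)) :
    1 ≤ d.κ₁⁻¹ :=
  (one_le_inv₀ d.κ₁_pos).2 (twoModeDataW_κ₁_le_one d)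

/-- `1 ≤ κ₂⁻¹` (`E₂ = κ₂⁻¹ - 1 ≥ 0`). [folklore] -/
theorem twoModeDataW_one_le_inv_κ₂ {hL : 0 < L} {hWm : Measurable W}
    {hW : ∫⁻ X in cellN N L, W X ≠ ⊤} (d : TwoModeData (formEmbedW hL hWm hW)) :
    1 ≤ d.κ₂⁻¹ :=
  (one_le_inv₀ d.κ₂_pos).2 (d.κ₂_le_κ₁.trans (twoModeDataW_κ₁_le_one d))

/-- **A normalised core function is a periodic trial state**: if `‖ι(graphEmbedW Φ)‖ = 1` then `Φ`,
with its `C¹`/periodicity/symmetry data, is a `PeriodicTrialState`. [folklore] -/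
def PeriodicTrialState.ofCoreW (hL : 0 < L) (hWm : Measurable W)
    (hW : ∫⁻ X in cellN N L, W X ≠ ⊤) (Φ : periodicCore N L)
    (h1 : ‖formEmbedW hL hWm hW ⟨graphEmbedW hL hWm hW Φ, graphEmbedW_mem_formDomainW hL hWm hW Φ⟩‖ = 1) :
    PeriodicTrialState N L where
  ψ := Φ
  contDiff := Φ.2.1
  periodic := Φ.2.2.1
  symm := Φ.2.2.2
  norm_eq := by
    have h := norm_formEmbedW_graphEmbedW_sq hL hWm hW Φ
    rw [h1, one_pow] at h
    exact (ENNReal.toReal_eq_one_iff _).1 h.symm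

/-- The energy of the trial state of a normalised core function: `periodicEnergy = ‖graphEmbedW Φ‖² - 1`.
[folklore] -/
theorem periodicEnergyW_ofCoreW (hL : 0 < L) (hWm : Measurable W)
    (hW : ∫⁻ X in cellN N L, W X ≠ ⊤) (Φ : periodicCore N L)
    (h1 : ‖formEmbedW hL hWm hW ⟨graphEmbedW hL hWm hW Φ, graphEmbedW_mem_formDomainW hL hWm hW Φ⟩‖ = 1) :
    periodicEnergyW W (PeriodicTrialState.ofCoreW hL hWm hW Φ h1) =
      ENNReal.ofReal (‖graphEmbedW hL hWm hW Φ‖ ^ 2 - 1) := by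
  have h := norm_graphEmbedW_sq_trialState hL hWm hW (PeriodicTrialState.ofCoreW hL hWm hW Φ h1)
  have hΦ : (⟨(PeriodicTrialState.ofCoreW hL hWm hW Φ h1).ψ,
      (PeriodicTrialState.ofCoreW hL hWm hW Φ h1).mem_periodicCore⟩ : periodicCore N L) = Φ := rfl
  rw [hΦ] at h
  have hfin : periodicEnergyW W (PeriodicTrialState.ofCoreW hL hWm hW Φ h1) ≠ ⊤ :=
    (lintegral_energyW_lt_top hWm hW Φ.2.1).ne
  rw [h, add_sub_cancel_left, ENNReal.ofReal_toReal hfin]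

/-- **Every trial state has energy at least `E₁ = κ₁⁻¹ - 1`.** [cite: ReedSimonIV1978, Thm. XIII.1] -/
theorem le_periodicEnergyW_of_twoModeData {hL : 0 < L} {hWm : Measurable W}
    {hW : ∫⁻ X in cellN N L, W X ≠ ⊤} (d : TwoModeData (formEmbedW hL hWm hW))
    (Ψ : PeriodicTrialState N L) : ENNReal.ofReal (d.κ₁⁻¹ - 1) ≤ periodicEnergyW W Ψ := by
  have h1 := norm_formEmbedW_graphEmbedW_trialState hL hWm hW Ψ
  have h2 := d.le_norm_sq h1
  change d.κ₁⁻¹ ≤ ‖graphEmbedW hL hWm hW ⟨Ψ.ψ, Ψ.mem_periodicCore⟩‖ ^ 2 at h2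
  rw [norm_graphEmbedW_sq_trialState] at h2
  calc ENNReal.ofReal (d.κ₁⁻¹ - 1) ≤ ENNReal.ofReal (periodicEnergyW W Ψ).toReal :=
        ENNReal.ofReal_le_ofReal (by linarith)
    _ ≤ periodicEnergyW W Ψ := ENNReal.ofReal_toReal_le

/-- **Every `L²`-orthogonal pair of trial states has total energy at least `E₁ + E₂ = κ₁⁻¹ + κ₂⁻¹ - 2`**
(Ky Fan's inequality, `Literature.Analysis.InnerProduct.TwoModeData.kyFan_two_le`).
[cite: ReedSimonIV1978, Thm. XIII.1–2] -/
theorem le_add_periodicEnergyW_of_twoModeData {hL : 0 < L} {hWm : Measurable W}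
    {hW : ∫⁻ X in cellN N L, W X ≠ ⊤} (d : TwoModeData (formEmbedW hL hWm hW))
    (Ψ₁ Ψ₂ : PeriodicTrialState N L) (horth : ∫ X in cellN N L, conj (Ψ₁.ψ X) * Ψ₂.ψ X = 0) :
    ENNReal.ofReal (d.κ₁⁻¹ + d.κ₂⁻¹ - 2) ≤ periodicEnergyW W Ψ₁ + periodicEnergyW W Ψ₂ := by
  have h1 := norm_formEmbedW_graphEmbedW_trialState hL hWm hW Ψ₁
  have h2 := norm_formEmbedW_graphEmbedW_trialState hL hWm hW Ψ₂
  have h12 : ⟪formEmbedW hL hWm hW ⟨graphEmbedW hL hWm hW ⟨Ψ₁.ψ, Ψ₁.mem_periodicCore⟩,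
      graphEmbedW_mem_formDomainW hL hWm hW _⟩, formEmbedW hL hWm hW ⟨graphEmbedW hL hWm hW
      ⟨Ψ₂.ψ, Ψ₂.mem_periodicCore⟩, graphEmbedW_mem_formDomainW hL hWm hW _⟩⟫_ℂ = 0 := by
    rw [inner_formEmbedW_graphEmbedW]; exact horth
  have h := d.kyFan_two_le h1 h2 h12
  change d.κ₁⁻¹ + d.κ₂⁻¹ ≤ ‖graphEmbedW hL hWm hW ⟨Ψ₁.ψ, Ψ₁.mem_periodicCore⟩‖ ^ 2 +
    ‖graphEmbedW hL hWm hW ⟨Ψ₂.ψ, Ψ₂.mem_periodicCore⟩‖ ^ 2 at h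
  rw [norm_graphEmbedW_sq_trialState, norm_graphEmbedW_sq_trialState] at h
  calc ENNReal.ofReal (d.κ₁⁻¹ + d.κ₂⁻¹ - 2)
      ≤ ENNReal.ofReal ((periodicEnergyW W Ψ₁).toReal + (periodicEnergyW W Ψ₂).toReal) :=
        ENNReal.ofReal_le_ofReal (by linarith)
    _ = ENNReal.ofReal (periodicEnergyW W Ψ₁).toReal + ENNReal.ofReal (periodicEnergyW W Ψ₂).toReal :=
        ENNReal.ofReal_add ENNReal.toReal_nonneg ENNReal.toReal_nonneg
    _ ≤ periodicEnergyW W Ψ₁ + periodicEnergyW W Ψ₂ := add_le_add ENNReal.ofReal_toReal_le ENNReal.ofReal_toReal_le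

/-- Elements of the core subspace of `Q` come from core functions. [folklore] -/
theorem exists_eq_graphEmbedW_of_mem_coreRangeW {hL : 0 < L} {hWm : Measurable W}
    {hW : ∫⁻ X in cellN N L, W X ≠ ⊤} {ψ : formDomainW hL hWm hW}
    (hψ : ψ ∈ coreRangeW hL hWm hW) :
    ∃ Φ : periodicCore N L, ψ = ⟨graphEmbedW hL hWm hW Φ, graphEmbedW_mem_formDomainW hL hWm hW Φ⟩ := by
  obtain ⟨Φ, hΦ⟩ := hψ
  exact ⟨Φ, Subtype.ext hΦ.symm⟩

/-- **The variational ground-state energy is the lowest form eigenvalue**: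
`periodicGroundStateEnergyW W L = κ₁⁻¹ - 1 (= E₁ ≥ 0)` for any `TwoModeData` of the embedding; in
particular it is attained (at `d.φ₁ ∈ Q`) and is an eigenvalue of the form.
[cite: ReedSimonIV1978, Thm. XIII.1] -/
theorem periodicGroundStateEnergyW_eq_ofReal {hL : 0 < L} {hWm : Measurable W}
    {hW : ∫⁻ X in cellN N L, W X ≠ ⊤} (d : TwoModeData (formEmbedW hL hWm hW)) :
    periodicGroundStateEnergyW W L = ENNReal.ofReal (d.κ₁⁻¹ - 1) := by
  refine le_antisymm ?_ (le_iInf fun Ψ => le_periodicEnergyW_of_twoModeData d Ψ)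
  refine ENNReal.le_of_forall_pos_le_add fun ε hε _ => ?_
  obtain ⟨ψ, hψS, hψ1, hlt⟩ := d.exists_lt_of_dense (dense_coreRangeW hL hWm hW) (ε := ε) (by exact_mod_cast hε)
  obtain ⟨Φ, rfl⟩ := exists_eq_graphEmbedW_of_mem_coreRangeW hψS
  calc periodicGroundStateEnergyW W L ≤ periodicEnergyW W (PeriodicTrialState.ofCoreW hL hWm hW Φ hψ1) := iInf_le _ _
    _ = ENNReal.ofReal (‖graphEmbedW hL hWm hW Φ‖ ^ 2 - 1) := periodicEnergyW_ofCoreW hL hWm hW Φ hψ1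
    _ ≤ ENNReal.ofReal (d.κ₁⁻¹ - 1 + ε) := ENNReal.ofReal_le_ofReal (by
        change ‖graphEmbedW hL hWm hW Φ‖ ^ 2 < d.κ₁⁻¹ + ε at hlt
        linarith)
    _ = ENNReal.ofReal (d.κ₁⁻¹ - 1) + ε := by
        rw [ENNReal.ofReal_add (by linarith [twoModeDataW_one_le_inv_κ₁ d]) ε.coe_nonneg, ENNReal.ofReal_coe_nnreal]
end Literature.MathematicalPhysics.QuantumManyBody.BoseGas

end
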